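import Literature.Geometry.Symplectic.SteinLiouvilleField
import Literature.Analysis.ODE.PfaffianTransportFactor
import Literature.Topology.FourManifolds.ChartDerivative
import HarnessLib

/-!
# Transport of the level contact data of a Stein domain along the normalised Liouville flow

Topic `Literature/Geometry/Symplectic`; proofs file of the fact seat of
`Literature.Geometry.Symplectic.Gompf1998_thm13_twoHandles` (**E2**, `SteinTwoHandles.lean`),
step "Gray transport along the levels of `φ`" (moving Legendrian attaching circles of twisting
`-1` from `∂W = {φ = max φ}` to a lower level `{φ = c}`, so that the 2-handles may be attached to
the shrunk Stein domain `{φ ≤ c} ⊂ int W` of `SteinDomainSublevel.lean`).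

`SteinLiouvilleField.lean` provides the flow-out input `D = S.liouvilleFlowout` whose field is
`ξ = -χ(φ) • Z`, `Z = Y / dφ(Y)` the normalised Liouville field (`ι_Y ω = λ`, `λ = -dφ ∘ J`,
`ω = dλ`): `dφ(ξ) = -χ(φ)`, `λ(ξ) = 0`, `ι_ξ ω = γ • λ`.  Hence `L_ξ dφ = -d(χ ∘ φ) ∈ span(dφ)`,
`L_ξ λ = ι_ξ dλ + d(λ(ξ)) = γ λ` and the flow of `ξ` maps levels of `φ` to levels of `φ` and the
complex tangencies `ker dφ ∩ ker λ` of one level onto those of the others — Gray's stability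
along the levels, realised by a Liouville-type flow (Cieliebak–Eliashberg 2012, §2, §11.1;
Geiges 2008, Thm. 2.2.2 for Gray's theorem).  This file proves the **differential** form of this
along the flow curves `C.curve z t` of a chart box `C` of `D` (`BoundaryFlowout.lean`), for
`t ∈ [0, ε]`:

* `hasMFDerivAt_curve` — `z ↦ C.curve z t` is differentiable, with differential
  `τ_{y→x} ∘ J_t ∘ τ_{z→y}` (`J` the linearised chart flow, `FlowWithin.lean`; `τ` tangent
  coordinate changes);
* `dφ_mfderiv_curve` — **levels to levels**: `dφ(D(curve_t) v) = dφ(v)`;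
* `exists_pos_contactForm_mfderiv_curve` — **`ker λ` to `ker λ`, conformally**:
  `λ(D(curve_t) v) = m λ(v)` with one `m > 0` for all `v`;
* `not_antipodal_mfderiv_curve` — for `a ∈ ker λ_z` and any `b`, the transported pair
  `(ω(Da, Db), λ(Db))` is not a negative multiple of `(ω(a, b), λ(b))` unless the latter is `0`
  (used for the invariance of twisting numbers of framed Legendrian knots).

The proofs read everything in the chart at the centre `y` of the box — the field
(`FlowoutInput.fieldIn`), the level function (`FlowoutInput.levelIn`), and the forms `λ`,
`ω = dλ`, `dω = 0` (`MForm.inChart`, `inChart_mextDeriv_of_mem_target`, `mextDeriv_mextDeriv`) —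
and apply the chart-level transport lemmas of `Analysis/ODE/PfaffianInvariance.lean` and
`PfaffianTransportFactor.lean`.  Everything is **proved**; no named fact.

## References

* K. Cieliebak, Ya. Eliashberg, *From Stein to Weinstein and Back*, AMS Colloquium Publ. 59
  (2012), §2 (`J`-convex functions and their Liouville fields), §11.1. [CieliebakEliashberg2012]
* S. Lang, *Differential and Riemannian Manifolds* (1995), Ch. IV §1 (linearised flow). [Lang1995]
* J. Milnor, *Lectures on the h-cobordism theorem* (1965), proof of Thm. 3.4. [MilnorHCobordism1965]
-/

noncomputable section

open scoped Manifold ContDiff Topology Bundle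
open Set Function Bundle Filter Metric

namespace Literature.Geometry.Symplectic

open Literature.Geometry.Kaehler Literature.Topology.FourManifolds Literature.Analysis.ODE

/-- The model vector space `ℝ⁴` of the tangent spaces. [folklore] -/
local notation "E4" => EuclideanSpace ℝ (Fin 4)

/-! ### Generic chart lemmas -/

section Generic

variable {E : Type*} [NormedAddCommGroup E] [NormedSpace ℝ E] {H : Type*} [TopologicalSpace H]
  {I : ModelWithCorners ℝ E H} {M : Type*} [TopologicalSpace M] [ChartedSpace H M]
  [IsManifold I ∞ M] {F : Type*} [NormedAddCommGroup F] [NormedSpace ℝ F] {k : ℕ}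

/-- The tangent coordinate changes `z → y` and `y → z` at `z` are mutually inverse (the other
composite of `tangentCoordChange_tangentCoordChange`). [folklore] -/
theorem tangentCoordChange_symm_apply {y z : M} (hz : z ∈ (chartAt H y).source) (v : E) :
    tangentCoordChange I y z z (tangentCoordChange I z y z v) = v := by
  have hzy : z ∈ (extChartAt I y).source := by rwa [extChartAt_source]
  have hzz : z ∈ (extChartAt I z).source := mem_extChartAt_source z
  rw [tangentCoordChange_comp ⟨⟨hzz, hzy⟩, hzz⟩, tangentCoordChange_self hzz]

/-- **A form evaluated on vectors given in the chart at `y`**: for `x` in the chart domain of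
`y`, `α.inChart y (c x) (w) = α x (τ w)`, `τ = tangentCoordChange I y x x`. [folklore] -/
theorem inChart_apply_extChartAt (α : MForm I M F k) {y x : M} (hx : x ∈ (chartAt H y).source)
    (w : Fin k → E) :
    α.inChart y (extChartAt I y x) w = α x (fun i => tangentCoordChange I y x x (w i)) := by
  have hxs : x ∈ (extChartAt I y).source := by rwa [extChartAt_source]
  rw [α.inChart_eq_of_mem_target ((extChartAt I y).map_source hxs), (extChartAt I y).left_inv hxs]
  rfl

/-- **The differential of `z' ↦ c⁻¹ (g (c z'))`** (`c` the extended chart at `y`): if `g` has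
derivative `G` within `range I` at `c z`, and maps the chart images of a neighbourhood `U` of
`z` (inside the chart domain) into the chart target, then the composite is differentiable at
`z` with differential `τ_{y→x} ∘ G ∘ τ_{z→y}`, `x = c⁻¹(g(c z))` (chain rule with
`hasMFDerivAt_extChartAt`, `mfderiv_chartAt_eq_tangentCoordChange` and
`mdifferentiableWithinAt_extChartAt_symm`). [folklore] -/
theorem hasMFDerivAt_symm_comp_comp_extChartAt {g : E → E} {G : E →L[ℝ] E} {y z : M}
    (hz : z ∈ (chartAt H y).source) {U : Set M} (hU : U ∈ 𝓝 z)
    (hmaps : ∀ z' ∈ U, g (extChartAt I y z') ∈ (extChartAt I y).target)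
    (hg : HasFDerivWithinAt g G (range I) (extChartAt I y z)) :
    HasMFDerivAt I I (fun z' => (extChartAt I y).symm (g (extChartAt I y z'))) z
      ((tangentCoordChange I y ((extChartAt I y).symm (g (extChartAt I y z)))
        ((extChartAt I y).symm (g (extChartAt I y z)))).comp
        (G.comp (tangentCoordChange I z y z)) :) := by
  have hzU : z ∈ U := mem_of_mem_nhds hU
  -- the chart
  have hc : HasMFDerivWithinAt I 𝓘(ℝ, E) (extChartAt I y) U z (tangentCoordChange I z y z :) :=
    ((hasMFDerivAt_extChartAt (I := I) hz).congr_mfderiv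
      (mfderiv_chartAt_eq_tangentCoordChange (I := I) hz)).hasMFDerivWithinAt
  -- `g`
  have hg' : HasMFDerivWithinAt 𝓘(ℝ, E) 𝓘(ℝ, E) g (range I) (extChartAt I y z) G :=
    hasMFDerivWithinAt_iff_hasFDerivWithinAt.2 hg
  have h1 : HasMFDerivWithinAt I 𝓘(ℝ, E) (g ∘ extChartAt I y) U z
      (G.comp (tangentCoordChange I z y z) :) :=
    hg'.comp z hc fun z' _ => by
      show extChartAt I y z' ∈ range I
      rw [extChartAt_coe]; exact mem_range_self _
  -- the inverse chart
  have htgt : g (extChartAt I y z) ∈ (extChartAt I y).target := hmaps z hzU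
  have hsymm : HasMFDerivWithinAt 𝓘(ℝ, E) I (extChartAt I y).symm (range I) (g (extChartAt I y z))
      (tangentCoordChange I y ((extChartAt I y).symm (g (extChartAt I y z)))
        ((extChartAt I y).symm (g (extChartAt I y z))) :) := by
    have h := (mdifferentiableWithinAt_extChartAt_symm htgt).hasMFDerivWithinAt
    rwa [mfderivWithin_extChartAt_symm_eq_tangentCoordChange htgt] at h
  have h2 := hsymm.comp z h1 fun z' hz' =>
    mem_preimage.2 (extChartAt_target_subset_range y (hmaps z' hz'))
  exact h2.hasMFDerivAt hU

/-- The trace of a ball on the model half-space `{x₀ ≥ 0}` of `ℝ⁴` lies in the closure of its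
interior (convex with an interior point `p + δ e₀`). [folklore] -/
theorem halfSpace_inter_ball_subset_closure_interior {p : E4}
    (hp : p ∈ Literature.Analysis.ODE.halfSpace (halfSpaceCoord 3)) {ρ : ℝ} (hρ : 0 < ρ) :
    Literature.Analysis.ODE.halfSpace (halfSpaceCoord 3) ∩ ball p ρ ⊆
      closure (interior (Literature.Analysis.ODE.halfSpace (halfSpaceCoord 3) ∩ ball p ρ)) := by
  have hconv : Convex ℝ (Literature.Analysis.ODE.halfSpace (halfSpaceCoord 3) ∩ ball p ρ) :=
    Literature.Analysis.ODE.convex_halfSpace.inter (convex_ball _ _)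
  have hint : (interior (Literature.Analysis.ODE.halfSpace (halfSpaceCoord 3) ∩ ball p ρ)).Nonempty := by
    set e₀ : E4 := EuclideanSpace.single 0 1 with he₀
    set δ : ℝ := ρ / 2 with hδ
    have hδpos : 0 < δ := by positivity
    refine ⟨p + δ • e₀, ?_⟩
    rw [interior_inter, isOpen_ball.interior_eq]
    refine ⟨?_, ?_⟩
    · apply interior_mono (show {x : E4 | 0 < halfSpaceCoord 3 x} ⊆
        Literature.Analysis.ODE.halfSpace (halfSpaceCoord 3) from
          fun x hx => Literature.Analysis.ODE.mem_halfSpace.2 (le_of_lt hx))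
      rw [(isOpen_lt continuous_const (halfSpaceCoord 3).continuous).interior_eq]
      show 0 < halfSpaceCoord 3 (p + δ • e₀)
      rw [map_add, map_smul, smul_eq_mul, halfSpaceCoord_apply, halfSpaceCoord_apply]
      have h1 : (0 : ℝ) ≤ p 0 := Literature.Analysis.ODE.mem_halfSpace.1 hp
      have h2 : e₀ 0 = 1 := by simp [he₀]
      rw [h2, mul_one]
      linarith
    · rw [mem_ball, dist_eq_norm, add_sub_cancel_left, norm_smul, Real.norm_of_nonneg hδpos.le]
      have : ‖e₀‖ = 1 := by simp [he₀]
      rw [this, mul_one, hδ]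
      linarith
  rw [hconv.closure_interior_eq_closure_of_nonempty_interior hint]
  exact subset_closure

/-- `extDerivWithin` within `s ∩ t` agrees with `extDerivWithin` within `s` at interior points
of `t`. [folklore] -/
theorem extDerivWithin_inter {n : ℕ} {α : E → E [⋀^Fin n]→L[ℝ] F} {s t : Set E} {x : E}
    (ht : t ∈ 𝓝 x) : extDerivWithin α (s ∩ t) x = extDerivWithin α s x := by
  simp only [extDerivWithin, fderivWithin_inter ht]

end Generic

/-! ### The linearised chart flow of a chart box of a flow-out input -/

end Literature.Geometry.Symplectic

namespace Literature.Topology.FourManifolds.FlowoutInput.ChartBox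

open Literature.Analysis.ODE Literature.Geometry.Symplectic

/-- The model vector space `ℝ⁴`. [folklore] -/
local notation "E4" => EuclideanSpace ℝ (Fin 4)

variable {W : Type*} [TopologicalSpace W] [ChartedSpace (EuclideanHalfSpace 4) W]
  [IsManifold (𝓡∂ 4) ∞ W] {D : FlowoutInput 3 W} {y : W} (C : D.ChartBox y)

/-- **The chart flows of a box form a solution family** of the field read in the chart, on
`[0, ε]`, indexed by the trace `{x₀ ≥ 0} ∩ B(p, r)` of the ball of initial conditions, inside
the trace `{x₀ ≥ 0} ∩ B(p, R)` of the analysis ball (any flow-out input `D`).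
[cite: Lang1995, Ch. IV §1, Prop. 1.1] -/
theorem isSolutionFamily_box :
    IsSolutionFamily (D.fieldIn y)
      (Literature.Analysis.ODE.halfSpace (halfSpaceCoord 3) ∩ ball (extChartAt (𝓡∂ 4) y y) C.R)
      (Literature.Analysis.ODE.halfSpace (halfSpaceCoord 3) ∩ ball (extChartAt (𝓡∂ 4) y y) C.box.r)
      C.box.ε C.box.flow := by
  refine ⟨fun q hq => C.box.flow_zero q (ball_subset_closedBall hq.2), fun q hq t ht => ?_,
    fun q hq t ht => ?_⟩
  · exact C.box.hasDerivWithinAt_Icc (isHalfSpaceRetraction_modelRetraction 3)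
      (FlowoutInput.extChartAt_mem_halfSpace (k := 3) y y) C.inward ⟨hq.1, ball_subset_closedBall hq.2⟩ ht
  · exact C.box.flow_mem (isHalfSpaceRetraction_modelRetraction 3)
      (FlowoutInput.extChartAt_mem_halfSpace (k := 3) y y) C.inward ⟨hq.1, ball_subset_closedBall hq.2⟩ ht

/-- **The linearised chart flow**: a solution `J q` of the linearised equation
`J' = DẐ(flow q t) ∘ J`, `J q 0 = id`, along every chart flow curve, which *is* the derivative of
the flow in the initial condition (`IsSolutionFamily.exists_linearization`,
`IsSolutionFamily.hasFDerivWithinAt`; any flow-out input `D`). [cite: Lang1995, Ch. IV §1, Thm. 1.14] -/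
theorem exists_linearization_box :
    ∃ J : E4 → ℝ → E4 →L[ℝ] E4,
      (∀ q ∈ Literature.Analysis.ODE.halfSpace (halfSpaceCoord 3) ∩ ball (extChartAt (𝓡∂ 4) y y) C.box.r,
        J q 0 = 1) ∧
      (∀ q ∈ Literature.Analysis.ODE.halfSpace (halfSpaceCoord 3) ∩ ball (extChartAt (𝓡∂ 4) y y) C.box.r,
        ∀ t ∈ Icc 0 C.box.ε, HasDerivWithinAt (J q)
          ((fderivWithin ℝ (D.fieldIn y)
            (Literature.Analysis.ODE.halfSpace (halfSpaceCoord 3) ∩ ball (extChartAt (𝓡∂ 4) y y) C.R)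
            (C.box.flow q t)).comp (J q t)) (Icc 0 C.box.ε) t) ∧
      ∀ q ∈ Literature.Analysis.ODE.halfSpace (halfSpaceCoord 3) ∩ ball (extChartAt (𝓡∂ 4) y y) C.box.r,
        ∀ τ ∈ Icc 0 C.box.ε, HasFDerivWithinAt (fun q' => C.box.flow q' τ) (J q τ)
          (Literature.Analysis.ODE.halfSpace (halfSpaceCoord 3) ∩ ball (extChartAt (𝓡∂ 4) y y) C.box.r) q := by
  have hfam := C.isSolutionFamily_box
  have hT : 0 ≤ C.box.ε := C.box.ε_pos.le
  have hRpos : 0 < C.R := C.box.r_pos.trans (C.box.r_lt.trans C.box.R'_lt)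
  have hSu := uniqueDiffOn_halfSpace_inter_ball (ℓ := halfSpaceCoord 3)
    (FlowoutInput.extChartAt_mem_halfSpace (k := 3) y y) hRpos
  have hF : ContDiffOn ℝ 1 (D.fieldIn y)
      (Literature.Analysis.ODE.halfSpace (halfSpaceCoord 3) ∩ ball (extChartAt (𝓡∂ 4) y y) C.R) :=
    C.contDiffOn_fieldIn.of_le (by norm_cast)
  have hconv : Convex ℝ (Literature.Analysis.ODE.halfSpace (halfSpaceCoord 3) ∩
      ball (extChartAt (𝓡∂ 4) y y) C.R) :=
    Literature.Analysis.ODE.convex_halfSpace.inter (convex_ball _ _)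
  obtain ⟨J, hJ0, hJ⟩ := hfam.exists_linearization hT hSu hF
  exact ⟨J, hJ0, hJ, fun q hq τ hτ => hfam.hasFDerivWithinAt hT hconv hSu hF hq (hJ0 q hq) (hJ q hq) hτ⟩

/-- For `t ∈ [0, ε]` the chart flow of a point of the domain stays in the trace of the analysis
ball (forward invariance of the half-space; no level condition is needed for positive times).
[folklore] -/
theorem flow_mem_of_mem_dom {z : W} (hz : z ∈ C.dom) {t : ℝ} (ht : t ∈ Icc 0 C.box.ε) :
    C.box.flow (extChartAt (𝓡∂ 4) y z) t ∈
      Literature.Analysis.ODE.halfSpace (halfSpaceCoord 3) ∩ ball (extChartAt (𝓡∂ 4) y y) C.R :=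
  C.box.flow_mem (isHalfSpaceRetraction_modelRetraction 3) (FlowoutInput.extChartAt_mem_halfSpace (k := 3) y y)
    C.inward (C.apply_mem hz) ht

/-- For `t ∈ [0, ε]` the flow curve of a point of the domain lies in the chart domain of `y`.
[folklore] -/
theorem curve_mem_source_of_mem_dom {z : W} (hz : z ∈ C.dom) {t : ℝ}
    (ht : t ∈ Icc 0 C.box.ε) : C.curve z t ∈ (chartAt (EuclideanHalfSpace 4) y).source := by
  rw [← extChartAt_source (I := 𝓡∂ 4)]
  exact (extChartAt (𝓡∂ 4) y).map_target (C.subset_target (C.flow_mem_of_mem_dom hz ht))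

/-- The chart image of the flow curve is the chart flow: `c (curve z t) = flow (c z) t`.
[folklore] -/
theorem extChartAt_curve {z : W} (hz : z ∈ C.dom) {t : ℝ} (ht : t ∈ Icc 0 C.box.ε) :
    extChartAt (𝓡∂ 4) y (C.curve z t) = C.box.flow (extChartAt (𝓡∂ 4) y z) t :=
  (extChartAt (𝓡∂ 4) y).right_inv (C.subset_target (C.flow_mem_of_mem_dom hz ht))

/-- **The flow curves are differentiable in the initial point**, with differential
`τ_{y→x} ∘ J_t ∘ τ_{z→y}` at `z` (`x = curve z t`), `J` the linearised chart flow (any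
flow-out input `D`). [cite: Lang1995, Ch. IV §1, Thm. 1.14] -/
theorem hasMFDerivAt_curve {J : E4 → ℝ → E4 →L[ℝ] E4}
    (hJd : ∀ q ∈ Literature.Analysis.ODE.halfSpace (halfSpaceCoord 3) ∩ ball (extChartAt (𝓡∂ 4) y y) C.box.r,
      ∀ τ ∈ Icc 0 C.box.ε, HasFDerivWithinAt (fun q' => C.box.flow q' τ) (J q τ)
        (Literature.Analysis.ODE.halfSpace (halfSpaceCoord 3) ∩ ball (extChartAt (𝓡∂ 4) y y) C.box.r) q)
    {z : W} (hz : z ∈ C.dom) {t : ℝ} (ht : t ∈ Icc 0 C.box.ε) :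
    HasMFDerivAt (𝓡∂ 4) (𝓡∂ 4) (fun z' => C.curve z' t) z
      ((tangentCoordChange (𝓡∂ 4) y (C.curve z t) (C.curve z t)).comp
        ((J (extChartAt (𝓡∂ 4) y z) t).comp (tangentCoordChange (𝓡∂ 4) z y z)) :) := by
  have hzs : z ∈ (chartAt (EuclideanHalfSpace 4) y).source := by
    rw [← extChartAt_source (I := 𝓡∂ 4)]; exact hz.1
  -- the derivative of the chart flow within `range I`
  have hA : Literature.Analysis.ODE.halfSpace (halfSpaceCoord 3) ∩ ball (extChartAt (𝓡∂ 4) y y) C.box.r ∈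
      𝓝[range (𝓡∂ 4)] (extChartAt (𝓡∂ 4) y z) := by
    rw [halfSpace_halfSpaceCoord]
    exact inter_mem_nhdsWithin _ (isOpen_ball.mem_nhds hz.2)
  have hg : HasFDerivWithinAt (fun q' => C.box.flow q' t) (J (extChartAt (𝓡∂ 4) y z) t)
      (range (𝓡∂ 4)) (extChartAt (𝓡∂ 4) y z) :=
    (hJd _ (C.apply_mem_ball hz) t ht).mono_of_mem_nhdsWithin hA
  exact hasMFDerivAt_symm_comp_comp_extChartAt hzs (C.isOpen_dom.mem_nhds hz)
    (fun z' hz' => C.subset_target (C.flow_mem_of_mem_dom hz' ht)) hg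

/-- The flow curves are differentiable in the initial point. [folklore] -/
theorem mdifferentiableAt_curve {z : W} (hz : z ∈ C.dom) {t : ℝ}
    (ht : t ∈ Icc 0 C.box.ε) : MDifferentiableAt (𝓡∂ 4) (𝓡∂ 4) (fun z' => C.curve z' t) z := by
  obtain ⟨J, -, -, hJd⟩ := C.exists_linearization_box
  exact (C.hasMFDerivAt_curve hJd hz ht).mdifferentiableAt

end Literature.Topology.FourManifolds.FlowoutInput.ChartBox

namespace Literature.Geometry.Symplectic

open Literature.Geometry.Kaehler Literature.Topology.FourManifolds Literature.Analysis.ODE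

/-- The model vector space `ℝ⁴` of the tangent spaces. [folklore] -/
local notation "E4" => EuclideanSpace ℝ (Fin 4)

namespace SteinStructure

variable {W : Type*} [TopologicalSpace W] [ChartedSpace (EuclideanHalfSpace 4) W]
  [IsManifold (𝓡∂ 4) ∞ W] [CompactSpace W] [T2Space W] (S : SteinStructure W)

omit [TopologicalSpace W] [ChartedSpace (EuclideanHalfSpace 4) W] [IsManifold (𝓡∂ 4) ∞ W]
  [CompactSpace W] [T2Space W] in
/-- The identity of `E4 →L E4` acts as the identity. [folklore] -/
theorem one_apply_E4 (w : E4) : (1 : E4 →L[ℝ] E4) w = w := rfl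

/-! ### The coefficient of the cut-off field -/

/-- The scalar coefficient `-(χ(φ) · dφ(Y)⁻¹)` of the flow-out field: `ξ = cutCoef • Y`.
[folklore] -/
def cutCoef (c₀ c₁ : ℝ) (z : W) : ℝ :=
  -(Real.smoothTransition ((S.φ z - c₀) / (c₁ - c₀)) * (S.dφ z (S.liouvilleVF z))⁻¹)

/-- `ξ = cutCoef • Y` (definitional). [folklore] -/
theorem cutLiouvilleVF_eq_smul (c₀ c₁ : ℝ) (z : W) :
    S.cutLiouvilleVF c₀ c₁ z = S.cutCoef c₀ c₁ z • S.liouvilleVF z := rfl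

/-- **The coefficient is smooth** when `φ` has no critical point of value `≥ c₀` (it is a
product of smooth functions on the open regular set and vanishes identically on `{φ < c₀}`).
[folklore] -/
theorem contMDiff_cutCoef {c₀ c₁ : ℝ} (hc : c₀ < c₁) (hreg : ∀ x, c₀ ≤ S.φ x → S.dφ x ≠ 0) :
    ContMDiff (𝓡∂ 4) 𝓘(ℝ, ℝ) ∞ (S.cutCoef c₀ c₁) := by
  intro x₁
  by_cases h : S.dφ x₁ ≠ 0
  · have h1 : ContMDiffAt (𝓡∂ 4) 𝓘(ℝ, ℝ) ∞
        (fun x => Real.smoothTransition ((S.φ x - c₀) / (c₁ - c₀))) x₁ :=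
      ((contDiff_smoothTransition_rescale c₀ c₁).contMDiff.comp S.φ_smooth) x₁
    have h2 : ContMDiffAt (𝓡∂ 4) 𝓘(ℝ, ℝ) ∞ (fun x => (S.dφ x (S.liouvilleVF x))⁻¹) x₁ :=
      (S.contMDiff_dφ_liouvilleVF x₁).inv₀ ((S.dφ_liouvilleVF_ne_zero_iff x₁).2 h)
    exact (h1.mul h2).neg
  · push Not at h
    have hlt : S.φ x₁ < c₀ := by
      by_contra hle
      exact hreg x₁ (not_lt.1 hle) h
    have hV : {x : W | S.φ x < c₀} ∈ 𝓝 x₁ :=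
      (isOpen_lt S.φ_smooth.continuous continuous_const).mem_nhds hlt
    refine (contMDiffAt_const (c := (0 : ℝ))).congr_of_eventuallyEq ?_
    filter_upwards [hV] with x hx
    show -(Real.smoothTransition ((S.φ x - c₀) / (c₁ - c₀)) * (S.dφ x (S.liouvilleVF x))⁻¹) = 0
    rw [smoothTransition_rescale_of_le hc hx.le, zero_mul, neg_zero]

/-- **`λ(ξ) = 0`** for the cut-off field. [folklore] -/
theorem contactForm_cutLiouvilleVF (c₀ c₁ : ℝ) (z : W) :
    S.contactForm z (S.cutLiouvilleVF c₀ c₁ z) = 0 := by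
  rw [cutLiouvilleVF_eq_smul, map_smul, S.contactForm_liouvilleVF, smul_zero]

/-- **`ι_ξ ω = cutCoef • λ`**: `ω(ξ, w) = cutCoef · λ(w)`. [folklore] -/
theorem kahlerForm_cutLiouvilleVF (c₀ c₁ : ℝ) (z : W) (w : E4) :
    S.kahlerForm z (S.cutLiouvilleVF c₀ c₁ z) w = S.cutCoef c₀ c₁ z * S.contactForm z w := by
  rw [cutLiouvilleVF_eq_smul, S.kahlerForm_smul_left, S.kahlerForm_liouvilleVF]

/-! ### The forms and the field read in a chart -/

section Chart

variable (y : W)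

omit [T2Space W] in
/-- **`λ` read in the chart at `y`, on vectors given in that chart**:
`Λ̂(c x)(w) = λ_x(τ_{y→x} w)`. [folklore] -/
theorem inChart_liouvilleForm_apply {x : W} (hx : x ∈ (chartAt (EuclideanHalfSpace 4) y).source)
    (w : E4) :
    (-dComplex S.J S.φ).inChart y (extChartAt (𝓡∂ 4) y x) ![w] =
      S.contactForm x (tangentCoordChange (𝓡∂ 4) y x x w) := by
  rw [inChart_apply_extChartAt _ hx, ← S.liouvilleForm_apply]
  congr 1
  funext i
  fin_cases i
  rfl

omit [T2Space W] in
/-- **`ω = dλ` read in the chart at `y`, on vectors given in that chart**: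
`Ω̂(c x)(w₁, w₂) = ω_x(τ w₁, τ w₂)`. [folklore] -/
theorem inChart_kahler_apply {x : W} (hx : x ∈ (chartAt (EuclideanHalfSpace 4) y).source)
    (w₁ w₂ : E4) :
    (mextDeriv (-dComplex S.J S.φ)).inChart y (extChartAt (𝓡∂ 4) y x) ![w₁, w₂] =
      S.kahlerForm x (tangentCoordChange (𝓡∂ 4) y x x w₁) (tangentCoordChange (𝓡∂ 4) y x x w₂) := by
  rw [inChart_apply_extChartAt _ hx, ← S.mextDeriv_liouvilleForm_apply]
  congr 1
  funext i
  fin_cases i <;> rfl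

/-- `λ` read in the chart is `C^∞` within `range I` at every point of the chart target.
[folklore] -/
theorem contDiffWithinAt_inChart_liouvilleForm {q : E4} (hq : q ∈ (extChartAt (𝓡∂ 4) y).target) :
    ContDiffWithinAt ℝ ∞ ((-dComplex S.J S.φ).inChart y) (range (𝓡∂ 4)) q := by
  have hz : (extChartAt (𝓡∂ 4) y).symm q ∈ (extChartAt (𝓡∂ 4) y).source :=
    (extChartAt (𝓡∂ 4) y).map_target hq
  have h := MForm.SmoothAt.contDiffWithinAt_inChart (α := -dComplex S.J S.φ) hz
    (S.isSmoothForm_liouvilleForm _)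
  rwa [(extChartAt (𝓡∂ 4) y).right_inv hq] at h

/-- `ω = dλ` read in the chart is `C^∞` within `range I` at every point of the chart target.
[folklore] -/
theorem contDiffWithinAt_inChart_kahler {q : E4} (hq : q ∈ (extChartAt (𝓡∂ 4) y).target) :
    ContDiffWithinAt ℝ ∞ ((mextDeriv (-dComplex S.J S.φ)).inChart y) (range (𝓡∂ 4)) q := by
  have hz : (extChartAt (𝓡∂ 4) y).symm q ∈ (extChartAt (𝓡∂ 4) y).source :=
    (extChartAt (𝓡∂ 4) y).map_target hq
  have hsm : IsSmoothForm (mextDeriv (-dComplex S.J S.φ)) :=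
    isSmoothForm_mextDeriv (inChart_mextDeriv_holds (𝓡∂ 4) W ℝ) S.isSmoothForm_liouvilleForm
  have h := MForm.SmoothAt.contDiffWithinAt_inChart (α := mextDeriv (-dComplex S.J S.φ)) hz (hsm _)
  rwa [(extChartAt (𝓡∂ 4) y).right_inv hq] at h

/-- **`dΛ̂ = Ω̂` on the chart target** (chart independence of `d`). [folklore] -/
theorem extDerivWithin_inChart_liouvilleForm {q : E4} (hq : q ∈ (extChartAt (𝓡∂ 4) y).target) :
    extDerivWithin ((-dComplex S.J S.φ).inChart y) (range (𝓡∂ 4)) q =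
      (mextDeriv (-dComplex S.J S.φ)).inChart y q :=
  (inChart_mextDeriv_of_mem_target _ hq (S.isSmoothForm_liouvilleForm _)).symm

/-- **`dΩ̂ = 0` on the chart target** (`d ∘ d = 0`). [folklore] -/
theorem extDerivWithin_inChart_kahler {q : E4} (hq : q ∈ (extChartAt (𝓡∂ 4) y).target) :
    extDerivWithin ((mextDeriv (-dComplex S.J S.φ)).inChart y) (range (𝓡∂ 4)) q = 0 := by
  have hsm : IsSmoothForm (mextDeriv (-dComplex S.J S.φ)) :=
    isSmoothForm_mextDeriv (inChart_mextDeriv_holds (𝓡∂ 4) W ℝ) S.isSmoothForm_liouvilleForm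
  rw [← inChart_mextDeriv_of_mem_target _ hq (hsm _),
    mextDeriv_mextDeriv (inChart_mextDeriv_holds (𝓡∂ 4) W ℝ) S.isSmoothForm_liouvilleForm,
    MForm.inChart_zero]
  rfl

variable {c₀ c₁ : ℝ} (hc : c₀ < c₁) (hc₁ : c₁ < sSup (range S.φ))
  (hreg : ∀ x, c₀ ≤ S.φ x → S.dφ x ≠ 0)

include hc hc₁ hreg

/-- **The flow-out field read in the chart annihilates `Λ̂`**: `Λ̂(q)(Ẑ q) = 0` on the chart
target (`λ(ξ) = 0`). [folklore] -/
theorem inChart_liouvilleForm_fieldIn {q : E4} (hq : q ∈ (extChartAt (𝓡∂ 4) y).target) :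
    (-dComplex S.J S.φ).inChart y q ![(S.liouvilleFlowout hc hc₁ hreg).fieldIn y q] = 0 := by
  set z := (extChartAt (𝓡∂ 4) y).symm q with hz
  have hzs : z ∈ (chartAt (EuclideanHalfSpace 4) y).source := by
    rw [← extChartAt_source (I := 𝓡∂ 4)]; exact (extChartAt (𝓡∂ 4) y).map_target hq
  have hqz : q = extChartAt (𝓡∂ 4) y z := ((extChartAt (𝓡∂ 4) y).right_inv hq).symm
  have hfield : (S.liouvilleFlowout hc hc₁ hreg).fieldIn y q =
      tangentCoordChange (𝓡∂ 4) z y z (S.cutLiouvilleVF c₀ c₁ z) := rfl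
  rw [hfield, hqz, S.inChart_liouvilleForm_apply y hzs, tangentCoordChange_symm_apply hzs,
    S.contactForm_cutLiouvilleVF]

/-- **`ι_Ẑ Ω̂ = γ̂ Λ̂` in the chart**: `Ω̂(q)(Ẑ q, w) = cutCoef(c⁻¹ q) · Λ̂(q)(w)` on the chart
target (`ω(ξ, ·) = cutCoef · λ`). [folklore] -/
theorem inChart_kahler_fieldIn {q : E4} (hq : q ∈ (extChartAt (𝓡∂ 4) y).target) (w : E4) :
    (mextDeriv (-dComplex S.J S.φ)).inChart y q ![(S.liouvilleFlowout hc hc₁ hreg).fieldIn y q, w] =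
      S.cutCoef c₀ c₁ ((extChartAt (𝓡∂ 4) y).symm q) • (-dComplex S.J S.φ).inChart y q ![w] := by
  set z := (extChartAt (𝓡∂ 4) y).symm q with hz
  have hzs : z ∈ (chartAt (EuclideanHalfSpace 4) y).source := by
    rw [← extChartAt_source (I := 𝓡∂ 4)]; exact (extChartAt (𝓡∂ 4) y).map_target hq
  have hqz : q = extChartAt (𝓡∂ 4) y z := ((extChartAt (𝓡∂ 4) y).right_inv hq).symm
  have hfield : (S.liouvilleFlowout hc hc₁ hreg).fieldIn y q =
      tangentCoordChange (𝓡∂ 4) z y z (S.cutLiouvilleVF c₀ c₁ z) := rfl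
  rw [hfield, hqz, S.inChart_kahler_apply y hzs, tangentCoordChange_symm_apply hzs,
    S.kahlerForm_cutLiouvilleVF, S.inChart_liouvilleForm_apply y hzs, smul_eq_mul]

omit hc₁ in
/-- The coefficient read in the chart is `C^∞` on the chart target (within). [folklore] -/
theorem contDiffOn_cutCoef_symm :
    ContDiffOn ℝ ∞ (fun q => S.cutCoef c₀ c₁ ((extChartAt (𝓡∂ 4) y).symm q))
      (extChartAt (𝓡∂ 4) y).target :=
  ((S.contMDiff_cutCoef hc hreg).comp_contMDiffOn
    (contMDiffOn_extChartAt_symm (I := 𝓡∂ 4) y)).contDiffOn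

end Chart

/-! ### The level of `φ` along the flow curves -/

section Box

variable {c₀ c₁ : ℝ} {hc : c₀ < c₁} {hc₁ : c₁ < sSup (range S.φ)}
  {hreg : ∀ x, c₀ ≤ S.φ x → S.dφ x ≠ 0} {D : FlowoutInput 3 W}
  (hD : D = S.liouvilleFlowout hc hc₁ hreg) {y : W} (C : D.ChartBox y)

include hD in
/-- **The level of `φ` drops by `t` along the flow curve** (for points with `f z ≤ ε`, in
particular boundary points): `φ (curve z t) = φ z - t`. [cite: MilnorHCobordism1965, proof of Thm. 3.4] -/
theorem φ_curve {z : W} (hz : z ∈ C.dom) (hfz : D.f z ≤ C.box.ε)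
    {t : ℝ} (ht : t ∈ Icc 0 C.box.ε) : S.φ (C.curve z t) = S.φ z - t := by
  have h := C.f_curve hz hfz (t := t) ⟨by linarith [D.f_nonneg z, ht.1], ht.2⟩
  subst hD
  simp only [liouvilleFlowout_f] at h
  linarith

/-! ### The hypotheses of the chart-level transport lemmas -/

include hD in
/-- **All chart-level hypotheses of the transport lemmas hold for a chart box.**  With
`s = {x₀ ≥ 0} ∩ B(p, R)`, `Ẑ` the field, `Λ̂`, `Ω̂` the forms `λ`, `ω` and `γ̂` the coefficient
read in the chart at `y`: `Λ̂`, `Ω̂`, `γ̂` are differentiable on `s`, `Ẑ` is differentiable on `s`,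
`s` is uniquely differentiable, `Λ̂(Ẑ) = 0`, `dΩ̂ = 0`, `ι_Ẑ Ω̂ = γ̂ Λ̂` and `dΛ̂ = Ω̂` on `s`.
[folklore] -/
theorem chart_hypotheses :
    let s := Literature.Analysis.ODE.halfSpace (halfSpaceCoord 3) ∩ ball (extChartAt (𝓡∂ 4) y y) C.R
    DifferentiableOn ℝ ((-dComplex S.J S.φ).inChart y) s ∧
      DifferentiableOn ℝ ((mextDeriv (-dComplex S.J S.φ)).inChart y) s ∧
      DifferentiableOn ℝ (fun q => S.cutCoef c₀ c₁ ((extChartAt (𝓡∂ 4) y).symm q)) s ∧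
      (∀ q ∈ s, HasFDerivWithinAt (D.fieldIn y) (fderivWithin ℝ (D.fieldIn y) s q) s q) ∧
      UniqueDiffOn ℝ s ∧
      (∀ q ∈ s, (-dComplex S.J S.φ).inChart y q ![D.fieldIn y q] = 0) ∧
      (∀ q ∈ s, extDerivWithin ((mextDeriv (-dComplex S.J S.φ)).inChart y) s q = 0) ∧
      (∀ q ∈ s, ∀ w, (mextDeriv (-dComplex S.J S.φ)).inChart y q ![D.fieldIn y q, w] =
        S.cutCoef c₀ c₁ ((extChartAt (𝓡∂ 4) y).symm q) • (-dComplex S.J S.φ).inChart y q ![w]) ∧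
      (∀ q ∈ s, extDerivWithin ((-dComplex S.J S.φ).inChart y) s q =
        (mextDeriv (-dComplex S.J S.φ)).inChart y q) := by
  intro s
  subst hD
  have hRpos : 0 < C.R := C.box.r_pos.trans (C.box.r_lt.trans C.box.R'_lt)
  have hSu : UniqueDiffOn ℝ s := uniqueDiffOn_halfSpace_inter_ball (ℓ := halfSpaceCoord 3)
    (FlowoutInput.extChartAt_mem_halfSpace (k := 3) y y) hRpos
  have hsub : s ⊆ (extChartAt (𝓡∂ 4) y).target := C.subset_target
  have hsI : s ⊆ range (𝓡∂ 4) := C.subset_range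
  have hsEq : s = range (𝓡∂ 4) ∩ ball (extChartAt (𝓡∂ 4) y y) C.R := by
    show Literature.Analysis.ODE.halfSpace (halfSpaceCoord 3) ∩ _ = _
    rw [halfSpace_halfSpaceCoord]
  have hball : ∀ q ∈ s, ball (extChartAt (𝓡∂ 4) y y) C.R ∈ 𝓝 q := fun q hq =>
    isOpen_ball.mem_nhds hq.2
  refine ⟨?_, ?_, ?_, ?_, hSu, ?_, ?_, ?_, ?_⟩
  · intro q hq
    exact ((S.contDiffWithinAt_inChart_liouvilleForm y (hsub hq)).differentiableWithinAt
      (by simp)).mono hsI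
  · intro q hq
    exact ((S.contDiffWithinAt_inChart_kahler y (hsub hq)).differentiableWithinAt (by simp)).mono hsI
  · exact ((S.contDiffOn_cutCoef_symm y hc hreg).mono hsub).differentiableOn (by simp)
  · intro q hq
    exact ((C.contDiffOn_fieldIn.differentiableOn (by simp)) q hq).hasFDerivWithinAt
  · intro q hq
    exact S.inChart_liouvilleForm_fieldIn y hc hc₁ hreg (hsub hq)
  · intro q hq
    rw [hsEq, extDerivWithin_inter (hball q hq)]
    exact S.extDerivWithin_inChart_kahler y (hsub hq)
  · intro q hq w
    exact S.inChart_kahler_fieldIn y hc hc₁ hreg (hsub hq) w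
  · intro q hq
    rw [hsEq, extDerivWithin_inter (hball q hq)]
    exact S.extDerivWithin_inChart_liouvilleForm y (hsub hq)

/-! ### Transport of the level data along the flow curves -/

include hD

/-- **The flow maps levels of `φ` to levels of `φ`, infinitesimally**: for `z` in the domain of
the box, `t ∈ [0, ε]` and `v ∈ T_zW`, `dφ(D(curve_t)_z v) = dφ_z(v)`.  In the chart at `y`:
`dΦ̂(Ẑ) = 1` for the level function `Φ̂ = f ∘ c⁻¹` (`f = max φ - φ`), so `L_Ẑ dΦ̂ = 0` and
`dΦ̂(flow_t q)(J_t v̂) = dΦ̂(q)(v̂)` (`fderivWithin_apply_linearization_eq`).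
[cite: MilnorHCobordism1965, proof of Thm. 3.4] -/
theorem dφ_mfderiv_curve {z : W} (hz : z ∈ C.dom) {t : ℝ} (ht : t ∈ Icc 0 C.box.ε) (v : E4) :
    S.dφ (C.curve z t) (mfderiv (𝓡∂ 4) (𝓡∂ 4) (fun z' => C.curve z' t) z v) = S.dφ z v := by
  obtain ⟨J, hJ0, hJode, hJd⟩ := C.exists_linearization_box
  obtain ⟨-, -, -, hZ, hSu, -, -, -, -⟩ := S.chart_hypotheses hD C
  have hzs : z ∈ (chartAt (EuclideanHalfSpace 4) y).source := by
    rw [← extChartAt_source (I := 𝓡∂ 4)]; exact hz.1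
  have hqA : extChartAt (𝓡∂ 4) y z ∈
      Literature.Analysis.ODE.halfSpace (halfSpaceCoord 3) ∩ ball (extChartAt (𝓡∂ 4) y y) C.box.r :=
    C.apply_mem_ball hz
  have hder := C.hasMFDerivAt_curve hJd hz ht
  have hxs : C.curve z t ∈ (chartAt (EuclideanHalfSpace 4) y).source :=
    C.curve_mem_source_of_mem_dom hz ht
  have hcx : extChartAt (𝓡∂ 4) y (C.curve z t) = C.box.flow (extChartAt (𝓡∂ 4) y z) t :=
    C.extChartAt_curve hz ht
  -- the level function in the chart: `dφ_x(τ w) = -dΦ̂(c x)(w)` (read in `ℝ`: the values of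
  -- `mfderiv` live in the tangent spaces `T_{φ x} ℝ = ℝ`)
  have hlev : ∀ {x' : W} (_ : x' ∈ (chartAt (EuclideanHalfSpace 4) y).source) (w : E4),
      @Eq ℝ (S.dφ x' (tangentCoordChange (𝓡∂ 4) y x' x' w))
        (-(fderivWithin ℝ (D.levelIn y) (range (𝓡∂ 4)) (extChartAt (𝓡∂ 4) y x') w)) := by
    intro x' hx' w
    have h : @Eq ℝ (mfderiv (𝓡∂ 4) 𝓘(ℝ, ℝ) D.f x' (tangentCoordChange (𝓡∂ 4) y x' x' w))
        (fderivWithin ℝ (D.levelIn y) (range (𝓡∂ 4)) (extChartAt (𝓡∂ 4) y x') w) :=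
      mfderiv_tangentCoordChange_apply (I := 𝓡∂ 4) (f := D.f) hx'
        (D.f_smooth.mdifferentiableAt (by simp)) w
    have hf : @Eq ℝ (mfderiv (𝓡∂ 4) 𝓘(ℝ, ℝ) D.f x' (tangentCoordChange (𝓡∂ 4) y x' x' w))
        (-(S.dφ x' (tangentCoordChange (𝓡∂ 4) y x' x' w))) := by
      subst hD
      show @Eq ℝ (mfderiv (𝓡∂ 4) 𝓘(ℝ, ℝ) (fun z => sSup (range S.φ) - S.φ z) x'
        (tangentCoordChange (𝓡∂ 4) y x' x' w)) _
      rw [S.mfderiv_sSup_sub_φ_apply]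
    rw [← h, hf, neg_neg]
  -- apply the chart-level transport of `dΦ̂`
  have hu : ∀ τ ∈ Icc 0 C.box.ε, HasDerivWithinAt (C.box.flow (extChartAt (𝓡∂ 4) y z))
      (D.fieldIn y (C.box.flow (extChartAt (𝓡∂ 4) y z) τ)) (Icc 0 C.box.ε) τ := fun τ hτ =>
    C.box.hasDerivWithinAt_Icc (isHalfSpaceRetraction_modelRetraction 3)
      (FlowoutInput.extChartAt_mem_halfSpace (k := 3) y y) C.inward (C.apply_mem hz) hτ
  have hus : ∀ τ ∈ Icc 0 C.box.ε, C.box.flow (extChartAt (𝓡∂ 4) y z) τ ∈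
      Literature.Analysis.ODE.halfSpace (halfSpaceCoord 3) ∩ ball (extChartAt (𝓡∂ 4) y y) C.R :=
    fun τ hτ => C.flow_mem_of_mem_dom hz hτ
  have hΦ : ContDiffOn ℝ 2 (D.levelIn y)
      (Literature.Analysis.ODE.halfSpace (halfSpaceCoord 3) ∩ ball (extChartAt (𝓡∂ 4) y y) C.R) :=
    C.contDiffOn_levelIn.of_le (by norm_cast)
  have hcl := halfSpace_inter_ball_subset_closure_interior
    (FlowoutInput.extChartAt_mem_halfSpace (k := 3) y y)
    (C.box.r_pos.trans (C.box.r_lt.trans C.box.R'_lt))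
  have htr := fderivWithin_apply_linearization_eq (Φ := D.levelIn y) hΦ hZ hSu hcl
    C.fderivWithin_levelIn hu hus (hJode _ hqA) (tangentCoordChange (𝓡∂ 4) z y z v) t ht
  -- translate back
  have hq0 : C.box.flow (extChartAt (𝓡∂ 4) y z) 0 = extChartAt (𝓡∂ 4) y z :=
    C.box.flow_zero _ (ball_subset_closedBall hqA.2)
  rw [hJ0 _ hqA, hq0] at htr
  have hball : ball (extChartAt (𝓡∂ 4) y y) C.R ∈ 𝓝 (C.box.flow (extChartAt (𝓡∂ 4) y z) t) :=
    isOpen_ball.mem_nhds (hus t ht).2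
  have hballq : ball (extChartAt (𝓡∂ 4) y y) C.R ∈ 𝓝 (extChartAt (𝓡∂ 4) y z) :=
    isOpen_ball.mem_nhds ((ball_subset_ball (C.box.r_lt.trans C.box.R'_lt).le) hqA.2)
  have hsEq : Literature.Analysis.ODE.halfSpace (halfSpaceCoord 3) ∩ ball (extChartAt (𝓡∂ 4) y y) C.R =
      range (𝓡∂ 4) ∩ ball (extChartAt (𝓡∂ 4) y y) C.R := by
    rw [halfSpace_halfSpaceCoord]
  rw [hsEq, fderivWithin_inter hball, fderivWithin_inter hballq, one_apply_E4] at htr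
  have hmf : mfderiv (𝓡∂ 4) (𝓡∂ 4) (fun z' => C.curve z' t) z v =
      tangentCoordChange (𝓡∂ 4) y (C.curve z t) (C.curve z t)
        (J (extChartAt (𝓡∂ 4) y z) t (tangentCoordChange (𝓡∂ 4) z y z v)) := by
    rw [hder.mfderiv]; rfl
  rw [hmf, hlev hxs, hcx, htr, ← hlev hzs, tangentCoordChange_symm_apply hzs]

/-- **The flow maps `ker λ` to `ker λ`, conformally**: for `z` in the domain of the box and
`t ∈ [0, ε]` there is `m > 0` with `λ(D(curve_t)_z v) = m · λ_z(v)` for all `v` (the conformal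
factor `exp ∫ γ̂` of `oneForm_apply_linearization_eq_pos_mul`: in the chart `Λ̂(Ẑ) = 0` and
`ι_Ẑ dΛ̂ = γ̂ Λ̂`, i.e. `L_Ẑ Λ̂ = γ̂ Λ̂`). [cite: CieliebakEliashberg2012, §2] -/
theorem exists_pos_contactForm_mfderiv_curve {z : W} (hz : z ∈ C.dom) {t : ℝ} (ht : t ∈ Icc 0 C.box.ε) :
    ∃ m : ℝ, 0 < m ∧ ∀ v : E4,
      S.contactForm (C.curve z t) (mfderiv (𝓡∂ 4) (𝓡∂ 4) (fun z' => C.curve z' t) z v) =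
        m * S.contactForm z v := by
  obtain ⟨J, hJ0, hJode, hJd⟩ := C.exists_linearization_box
  obtain ⟨hΛ, -, hγ, hZ, hSu, h0, -, hcon, hdω⟩ := S.chart_hypotheses hD C
  have hzs : z ∈ (chartAt (EuclideanHalfSpace 4) y).source := by
    rw [← extChartAt_source (I := 𝓡∂ 4)]; exact hz.1
  have hqA : extChartAt (𝓡∂ 4) y z ∈
      Literature.Analysis.ODE.halfSpace (halfSpaceCoord 3) ∩ ball (extChartAt (𝓡∂ 4) y y) C.box.r :=
    C.apply_mem_ball hz
  have hder := C.hasMFDerivAt_curve hJd hz ht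
  have hxs : C.curve z t ∈ (chartAt (EuclideanHalfSpace 4) y).source :=
    C.curve_mem_source_of_mem_dom hz ht
  have hcx : extChartAt (𝓡∂ 4) y (C.curve z t) = C.box.flow (extChartAt (𝓡∂ 4) y z) t :=
    C.extChartAt_curve hz ht
  have hu : ∀ τ ∈ Icc 0 C.box.ε, HasDerivWithinAt (C.box.flow (extChartAt (𝓡∂ 4) y z))
      (D.fieldIn y (C.box.flow (extChartAt (𝓡∂ 4) y z) τ)) (Icc 0 C.box.ε) τ := fun τ hτ =>
    C.box.hasDerivWithinAt_Icc (isHalfSpaceRetraction_modelRetraction 3)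
      (FlowoutInput.extChartAt_mem_halfSpace (k := 3) y y) C.inward (C.apply_mem hz) hτ
  have hus : ∀ τ ∈ Icc 0 C.box.ε, C.box.flow (extChartAt (𝓡∂ 4) y z) τ ∈
      Literature.Analysis.ODE.halfSpace (halfSpaceCoord 3) ∩ ball (extChartAt (𝓡∂ 4) y y) C.R :=
    fun τ hτ => C.flow_mem_of_mem_dom hz hτ
  have hd : ∀ q' ∈ Literature.Analysis.ODE.halfSpace (halfSpaceCoord 3) ∩ ball (extChartAt (𝓡∂ 4) y y) C.R,
      ∀ w, extDerivWithin ((-dComplex S.J S.φ).inChart y)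
        (Literature.Analysis.ODE.halfSpace (halfSpaceCoord 3) ∩ ball (extChartAt (𝓡∂ 4) y y) C.R) q'
        ![D.fieldIn y q', w] =
        S.cutCoef c₀ c₁ ((extChartAt (𝓡∂ 4) y).symm q') • (-dComplex S.J S.φ).inChart y q' ![w] :=
    fun q' hq' w => by rw [hdω q' hq']; exact hcon q' hq' w
  have hγu : ContinuousOn (fun τ => S.cutCoef c₀ c₁ ((extChartAt (𝓡∂ 4) y).symm
      (C.box.flow (extChartAt (𝓡∂ 4) y z) τ))) (Icc 0 C.box.ε) :=
    hγ.continuousOn.comp (fun τ hτ => (hu τ hτ).continuousWithinAt) fun τ hτ => hus τ hτ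
  obtain ⟨m, hm, hmul⟩ := oneForm_apply_linearization_eq_pos_mul hΛ hZ hSu h0 hd hu hus
    (hJode _ hqA) hγu ht
  refine ⟨m, hm, fun v => ?_⟩
  have h := hmul (tangentCoordChange (𝓡∂ 4) z y z v)
  have hq0 : C.box.flow (extChartAt (𝓡∂ 4) y z) 0 = extChartAt (𝓡∂ 4) y z :=
    C.box.flow_zero _ (ball_subset_closedBall hqA.2)
  rw [hJ0 _ hqA, hq0, one_apply_E4] at h
  have hmf : mfderiv (𝓡∂ 4) (𝓡∂ 4) (fun z' => C.curve z' t) z v =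
      tangentCoordChange (𝓡∂ 4) y (C.curve z t) (C.curve z t)
        (J (extChartAt (𝓡∂ 4) y z) t (tangentCoordChange (𝓡∂ 4) z y z v)) := by
    rw [hder.mfderiv]; rfl
  rw [hmf, ← S.inChart_liouvilleForm_apply y hxs, hcx, h, S.inChart_liouvilleForm_apply y hzs,
    tangentCoordChange_symm_apply hzs]

/-- **The transported pair `(ω(Da, Db), λ(Db))` is never a negative multiple of
`(ω(a, b), λ(b))`** (unless the latter vanishes), for `a ∈ ker λ_z`: the chart-level
`twoForm_oneForm_not_antipodal` (there `Ω̂ = dΛ̂` is closed and `ι_Ẑ Ω̂ = γ̂ Λ̂`).  This is what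
makes the straight-line homotopy between the twisting loop of a framed Legendrian knot and that of
its image under the flow zero-free. [cite: CieliebakEliashberg2012, §2] -/
theorem not_antipodal_mfderiv_curve {z : W} (hz : z ∈ C.dom) {t : ℝ} (ht : t ∈ Icc 0 C.box.ε)
    {a b : E4} (ha : S.contactForm z a = 0) {μ : ℝ} (hμ : 0 < μ)
    (hG : S.kahlerForm (C.curve z t) (mfderiv (𝓡∂ 4) (𝓡∂ 4) (fun z' => C.curve z' t) z a)
      (mfderiv (𝓡∂ 4) (𝓡∂ 4) (fun z' => C.curve z' t) z b) = -μ * S.kahlerForm z a b)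
    (hH : S.contactForm (C.curve z t) (mfderiv (𝓡∂ 4) (𝓡∂ 4) (fun z' => C.curve z' t) z b) =
      -μ * S.contactForm z b) :
    S.kahlerForm z a b = 0 ∧ S.contactForm z b = 0 := by
  obtain ⟨J, hJ0, hJode, hJd⟩ := C.exists_linearization_box
  obtain ⟨hΛ, hΩ, hγ, hZ, hSu, h0, hclosed, hcon, hdω⟩ := S.chart_hypotheses hD C
  have hzs : z ∈ (chartAt (EuclideanHalfSpace 4) y).source := by
    rw [← extChartAt_source (I := 𝓡∂ 4)]; exact hz.1
  have hqA : extChartAt (𝓡∂ 4) y z ∈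
      Literature.Analysis.ODE.halfSpace (halfSpaceCoord 3) ∩ ball (extChartAt (𝓡∂ 4) y y) C.box.r :=
    C.apply_mem_ball hz
  have hder := C.hasMFDerivAt_curve hJd hz ht
  have hxs : C.curve z t ∈ (chartAt (EuclideanHalfSpace 4) y).source :=
    C.curve_mem_source_of_mem_dom hz ht
  have hcx : extChartAt (𝓡∂ 4) y (C.curve z t) = C.box.flow (extChartAt (𝓡∂ 4) y z) t :=
    C.extChartAt_curve hz ht
  have hu : ∀ τ ∈ Icc 0 C.box.ε, HasDerivWithinAt (C.box.flow (extChartAt (𝓡∂ 4) y z))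
      (D.fieldIn y (C.box.flow (extChartAt (𝓡∂ 4) y z) τ)) (Icc 0 C.box.ε) τ := fun τ hτ =>
    C.box.hasDerivWithinAt_Icc (isHalfSpaceRetraction_modelRetraction 3)
      (FlowoutInput.extChartAt_mem_halfSpace (k := 3) y y) C.inward (C.apply_mem hz) hτ
  have hus : ∀ τ ∈ Icc 0 C.box.ε, C.box.flow (extChartAt (𝓡∂ 4) y z) τ ∈
      Literature.Analysis.ODE.halfSpace (halfSpaceCoord 3) ∩ ball (extChartAt (𝓡∂ 4) y y) C.R :=
    fun τ hτ => C.flow_mem_of_mem_dom hz hτ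
  have hγu : ContinuousOn (fun τ => S.cutCoef c₀ c₁ ((extChartAt (𝓡∂ 4) y).symm
      (C.box.flow (extChartAt (𝓡∂ 4) y z) τ))) (Icc 0 C.box.ε) :=
    hγ.continuousOn.comp (fun τ hτ => (hu τ hτ).continuousWithinAt) fun τ hτ => hus τ hτ
  have hq0 : C.box.flow (extChartAt (𝓡∂ 4) y z) 0 = extChartAt (𝓡∂ 4) y z :=
    C.box.flow_zero _ (ball_subset_closedBall hqA.2)
  -- chart versions of the vectors and of the hypotheses
  have hmf : ∀ v, mfderiv (𝓡∂ 4) (𝓡∂ 4) (fun z' => C.curve z' t) z v =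
      tangentCoordChange (𝓡∂ 4) y (C.curve z t) (C.curve z t)
        (J (extChartAt (𝓡∂ 4) y z) t (tangentCoordChange (𝓡∂ 4) z y z v)) := fun v => by
    rw [hder.mfderiv]; rfl
  have hΛz : ∀ v, (-dComplex S.J S.φ).inChart y (extChartAt (𝓡∂ 4) y z)
      ![tangentCoordChange (𝓡∂ 4) z y z v] = S.contactForm z v := fun v => by
    rw [S.inChart_liouvilleForm_apply y hzs, tangentCoordChange_symm_apply hzs]
  have hΩz : ∀ v w, (mextDeriv (-dComplex S.J S.φ)).inChart y (extChartAt (𝓡∂ 4) y z)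
      ![tangentCoordChange (𝓡∂ 4) z y z v, tangentCoordChange (𝓡∂ 4) z y z w] = S.kahlerForm z v w :=
    fun v w => by
    rw [S.inChart_kahler_apply y hzs, tangentCoordChange_symm_apply hzs,
      tangentCoordChange_symm_apply hzs]
  have hΛx : ∀ w, (-dComplex S.J S.φ).inChart y (C.box.flow (extChartAt (𝓡∂ 4) y z) t) ![w] =
      S.contactForm (C.curve z t) (tangentCoordChange (𝓡∂ 4) y (C.curve z t) (C.curve z t) w) :=
    fun w => by rw [← hcx, S.inChart_liouvilleForm_apply y hxs]
  have hΩx : ∀ w₁ w₂, (mextDeriv (-dComplex S.J S.φ)).inChart y (C.box.flow (extChartAt (𝓡∂ 4) y z) t)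
      ![w₁, w₂] = S.kahlerForm (C.curve z t) (tangentCoordChange (𝓡∂ 4) y (C.curve z t) (C.curve z t) w₁)
        (tangentCoordChange (𝓡∂ 4) y (C.curve z t) (C.curve z t) w₂) :=
    fun w₁ w₂ => by rw [← hcx, S.inChart_kahler_apply y hxs]
  have ha' : (-dComplex S.J S.φ).inChart y (C.box.flow (extChartAt (𝓡∂ 4) y z) 0)
      ![J (extChartAt (𝓡∂ 4) y z) 0 (tangentCoordChange (𝓡∂ 4) z y z a)] = 0 := by
    rw [hJ0 _ hqA, hq0, one_apply_E4, hΛz, ha]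
  have hG' : (mextDeriv (-dComplex S.J S.φ)).inChart y (C.box.flow (extChartAt (𝓡∂ 4) y z) t)
      ![J (extChartAt (𝓡∂ 4) y z) t (tangentCoordChange (𝓡∂ 4) z y z a),
        J (extChartAt (𝓡∂ 4) y z) t (tangentCoordChange (𝓡∂ 4) z y z b)] =
      -μ * (mextDeriv (-dComplex S.J S.φ)).inChart y (C.box.flow (extChartAt (𝓡∂ 4) y z) 0)
        ![J (extChartAt (𝓡∂ 4) y z) 0 (tangentCoordChange (𝓡∂ 4) z y z a),
          J (extChartAt (𝓡∂ 4) y z) 0 (tangentCoordChange (𝓡∂ 4) z y z b)] := by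
    rw [hJ0 _ hqA, hq0, one_apply_E4, one_apply_E4, hΩz, hΩx,
      ← hmf, ← hmf]
    exact hG
  have hH' : (-dComplex S.J S.φ).inChart y (C.box.flow (extChartAt (𝓡∂ 4) y z) t)
      ![J (extChartAt (𝓡∂ 4) y z) t (tangentCoordChange (𝓡∂ 4) z y z b)] =
      -μ * (-dComplex S.J S.φ).inChart y (C.box.flow (extChartAt (𝓡∂ 4) y z) 0)
        ![J (extChartAt (𝓡∂ 4) y z) 0 (tangentCoordChange (𝓡∂ 4) z y z b)] := by
    rw [hJ0 _ hqA, hq0, one_apply_E4, hΛz, hΛx, ← hmf]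
    exact hH
  -- restrict the time interval to `[0, t]` and apply the chart-level statement with `T = t`
  have hsub : Icc 0 t ⊆ Icc 0 C.box.ε := Icc_subset_Icc le_rfl ht.2
  have hu' : ∀ τ ∈ Icc 0 t, HasDerivWithinAt (C.box.flow (extChartAt (𝓡∂ 4) y z))
      (D.fieldIn y (C.box.flow (extChartAt (𝓡∂ 4) y z) τ)) (Icc 0 t) τ :=
    fun τ hτ => (hu τ (hsub hτ)).mono hsub
  have hus' : ∀ τ ∈ Icc 0 t, C.box.flow (extChartAt (𝓡∂ 4) y z) τ ∈
      Literature.Analysis.ODE.halfSpace (halfSpaceCoord 3) ∩ ball (extChartAt (𝓡∂ 4) y y) C.R :=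
    fun τ hτ => hus τ (hsub hτ)
  have hJ' : ∀ τ ∈ Icc 0 t, HasDerivWithinAt (J (extChartAt (𝓡∂ 4) y z))
      ((fderivWithin ℝ (D.fieldIn y)
        (Literature.Analysis.ODE.halfSpace (halfSpaceCoord 3) ∩ ball (extChartAt (𝓡∂ 4) y y) C.R)
        (C.box.flow (extChartAt (𝓡∂ 4) y z) τ)).comp (J (extChartAt (𝓡∂ 4) y z) τ)) (Icc 0 t) τ :=
    fun τ hτ => (hJode _ hqA τ (hsub hτ)).mono hsub
  have hγu' := hγu.mono hsub
  have h := twoForm_oneForm_not_antipodal hΩ hΛ hZ hγ hSu h0 hclosed hcon hdω hu' hus' hJ'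
    hγu' ht.1 ha' hμ hG' hH'
  rw [hJ0 _ hqA, hq0, one_apply_E4, one_apply_E4, hΩz,
    hΛz] at h
  exact h

end Box

end SteinStructure

end Literature.Geometry.Symplectic

end
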